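import Summits.AtomisticToContinuum.BoseEinsteinCondensation.Theorems.SoloInformedEntropicCriterion

/-!
# The teleportation functional: gauge form, pair identity, positive-type bound

Soloist report `solo-AtomisticToContinuum-informed`, `paper/sharpest.md` §4.2 and §4.7–4.8.

Setting as in `SoloInformedEntropicCriterion` (finite one-particle space `T`; `Ψ` on `T^{n+1}`
with positive slices; `Z = ∑ Ψ²`, `S_Y = ∑ₓ Ψ(x,Y)²`, `P(Y) = S_Y/Z`, `p_Y = Ψ(·,Y)²/S_Y`,
`η` the one-particle density). The normalisation-free Jeffreys sum
`𝒥(Ψ) = ∑_Y ∑ₓ (η(x) S_Y - Ψ(x,Y)²)(log η(x) - log Ψ(x,Y)²) = Z · E_P J(η, p_Y)` bounds the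
condensate fraction in the mode `√η` from below by `e^{-𝒥/(2Z)}`
(`SoloInformed.sqrtDensity_occupation_ge_of_sum_jeffreys_le`). This file records its structure.

* `SoloInformed.sum_jeffreys_eq_sum_teleportation` (GAUGE FORM). If
  `log Ψ(x,Y)² = a(x) + b(Y) - W(x,Y)` with any one-body `a` and environment-only `b`, then
  `𝒥(Ψ) = ∑_Y ∑ₓ (η(x) S_Y - Ψ(x,Y)²) W(x,Y) = Z · T[W]`, `T[W] = E_P (E_η - E_{p_Y}) W_Y`: the
  cost, measured by `W`, of "teleporting" the first particle from its conditional law `p_Y` to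
  its marginal `η`. One-body factors and all normalisations are invisible to `T`.
* `SoloInformed.sum_teleportation_pair_eq` (PAIR IDENTITY). For SYMMETRIC `Ψ` and a pair term
  `W(x,Y) = ∑ⱼ K(x,Yⱼ)` (any kernel `K`): `Z · T[W] = n q Z - E'`, `q = ∑ η(y) η(x) K(x,y)`,
  `E' = ∑_X Ψ(X)² ∑_{j≥1} K(X₀,Xⱼ)` (exchangeability).
* `SoloInformed.pairSum_ge_of_posDef`. For `K` symmetric, positive semi-definite on finite
  families, `K(x,x) ≤ κ`, and symmetric `Ψ`: `E' ≥ ((n+1) q - κ) Z` — positive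
  semi-definiteness tested on the signed measure `∑ᵢ δ_{Xᵢ} - (n+1) η` [cite: Ruelle1969, §3.2].
* `SoloInformed.sum_teleportation_pair_le_selfEnergy`: hence `Z · T[W_K] ≤ (κ - q) Z` (and
  `q ≥ 0`, `SoloInformed.smearedSelfEnergy_nonneg`) for EVERY symmetric state — in particular
  for the interacting ground state `Ψ₀`: a positive-type pair part of `-log Ψ₀²` costs at most
  its self-energy `κ`, whatever the rest of `Ψ₀` is (report §4.7, "pair-level dressing is free",
  now unconditional in the state).
* `SoloInformed.sum_teleportation_pair_le_of_nonneg`: for `K ≥ 0` pointwise and symmetric `Ψ`,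
  `Z · T[W_K] ≤ n q Z` (`n q ≈ ρ ∫ K`: the integrable-core cost); and
  `SoloInformed.sum_teleportation_le_of_nonneg`, the sup form for any `W ≥ 0` without symmetry.
* `SoloInformed.sum_teleportation_add`: `T[W₁ + W₂] = T[W₁] + T[W₂]`.

Consequences: the hybrid Jastrow theorem (`SoloInformedHybridJastrow`: soft core of positive
integral plus positive-type tail ⇒ condensate fraction `≥ exp(-½(κ - q₁ + n q₂))` uniformly in
`N` and the volume), and the decomposition behind the obstruction statement (ML-T) of the
report: `T[-log Ψ₀²] = T[W_K] + T[R] ≤ κ + T[R]` for any splitting of `-log Ψ₀²` into a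
positive-type pair part and a remainder `R` — the wall is `T[R]` alone.
-/

noncomputable section

open Finset

namespace Summit.AtomisticToContinuum.BoseEinsteinCondensation.Theorems

section Teleportation

variable {T : Type*} [Fintype T] [Nonempty T] {n : ℕ}

/-- **Gauge form of the Jeffreys sum**: if `log Ψ(x,Y)² = a(x) + b(Y) - W(x,Y)`, then
`∑_Y ∑ₓ (η(x) S_Y - Ψ(x,Y)²)(log η(x) - log Ψ(x,Y)²) = ∑_Y ∑ₓ (η(x) S_Y - Ψ(x,Y)²) W(x,Y)`:
environment-only terms die slice by slice (`∑ₓ (η S_Y - Ψ²) = 0`), one-body terms die after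
the sum over `Y` (`∑_Y (η(x) S_Y - Ψ(x,Y)²) = η(x) Z - η(x) Z = 0`). -/
theorem SoloInformed.sum_jeffreys_eq_sum_teleportation
    (Ψ : (Fin (n + 1) → T) → ℝ) (hg : ∀ (x : T) (Y : Fin n → T), 0 < Ψ (Matrix.vecCons x Y))
    (η : T → ℝ) (hη : ∀ x, η x = (∑ Y : Fin n → T, Ψ (Matrix.vecCons x Y) ^ 2) / ∑ X, Ψ X ^ 2)
    (W : T → (Fin n → T) → ℝ) (a : T → ℝ) (b : (Fin n → T) → ℝ)
    (hW : ∀ (x : T) (Y : Fin n → T), Real.log (Ψ (Matrix.vecCons x Y) ^ 2) = a x + b Y - W x Y) :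
    ∑ Y : Fin n → T, ∑ x, (η x * (∑ x', Ψ (Matrix.vecCons x' Y) ^ 2) -
        Ψ (Matrix.vecCons x Y) ^ 2) * (Real.log (η x) - Real.log (Ψ (Matrix.vecCons x Y) ^ 2)) =
      ∑ Y : Fin n → T, ∑ x, (η x * (∑ x', Ψ (Matrix.vecCons x' Y) ^ 2) -
        Ψ (Matrix.vecCons x Y) ^ 2) * W x Y := by
  obtain ⟨-, -, hη1, hmarg⟩ := SoloInformed.density_pos_and_sum_eq_one Ψ hg η hη
  obtain ⟨Z, hZ⟩ : ∃ r : ℝ, r = ∑ X, Ψ X ^ 2 := ⟨_, rfl⟩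
  rw [← hZ] at hmarg
  have hZ' : ∑ Y : Fin n → T, ∑ x', Ψ (Matrix.vecCons x' Y) ^ 2 = Z := by
    rw [hZ, SoloInformed.sum_config_eq_sum_vecCons (fun X => Ψ X ^ 2)]; exact Finset.sum_comm
  have hT2 : ∀ Y : Fin n → T, ∑ x, (η x * (∑ x', Ψ (Matrix.vecCons x' Y) ^ 2) -
      Ψ (Matrix.vecCons x Y) ^ 2) * b Y = 0 := by
    intro Y
    rw [← Finset.sum_mul, Finset.sum_sub_distrib, ← Finset.sum_mul, hη1, one_mul, sub_self,
      zero_mul]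
  have hT1 : ∑ Y : Fin n → T, ∑ x, (η x * (∑ x', Ψ (Matrix.vecCons x' Y) ^ 2) -
      Ψ (Matrix.vecCons x Y) ^ 2) * (Real.log (η x) - a x) = 0 := by
    rw [Finset.sum_comm]
    refine Finset.sum_eq_zero fun x _ => ?_
    rw [← Finset.sum_mul, Finset.sum_sub_distrib, ← Finset.mul_sum, hmarg x, hZ', sub_self,
      zero_mul]
  calc ∑ Y : Fin n → T, ∑ x, (η x * (∑ x', Ψ (Matrix.vecCons x' Y) ^ 2) -
        Ψ (Matrix.vecCons x Y) ^ 2) * (Real.log (η x) - Real.log (Ψ (Matrix.vecCons x Y) ^ 2))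
      = ∑ Y : Fin n → T, ∑ x, ((η x * (∑ x', Ψ (Matrix.vecCons x' Y) ^ 2) -
          Ψ (Matrix.vecCons x Y) ^ 2) * (Real.log (η x) - a x) -
          (η x * (∑ x', Ψ (Matrix.vecCons x' Y) ^ 2) - Ψ (Matrix.vecCons x Y) ^ 2) * b Y +
          (η x * (∑ x', Ψ (Matrix.vecCons x' Y) ^ 2) - Ψ (Matrix.vecCons x Y) ^ 2) * W x Y) := by
        refine Finset.sum_congr rfl fun Y _ => Finset.sum_congr rfl fun x _ => ?_
        rw [hW x Y]
        ring
    _ = 0 - 0 + ∑ Y : Fin n → T, ∑ x, (η x * (∑ x', Ψ (Matrix.vecCons x' Y) ^ 2) -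
          Ψ (Matrix.vecCons x Y) ^ 2) * W x Y := by
        simp only [Finset.sum_add_distrib, Finset.sum_sub_distrib]
        rw [hT1, Finset.sum_eq_zero fun Y _ => hT2 Y]
    _ = _ := by ring

omit [Nonempty T] in
/-- `T[W₁ + W₂] = T[W₁] + T[W₂]`. -/
theorem SoloInformed.sum_teleportation_add (Ψ : (Fin (n + 1) → T) → ℝ) (η : T → ℝ)
    (W₁ W₂ : T → (Fin n → T) → ℝ) :
    ∑ Y : Fin n → T, ∑ x, (η x * (∑ x', Ψ (Matrix.vecCons x' Y) ^ 2) -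
        Ψ (Matrix.vecCons x Y) ^ 2) * (W₁ x Y + W₂ x Y) =
      ∑ Y : Fin n → T, ∑ x, (η x * (∑ x', Ψ (Matrix.vecCons x' Y) ^ 2) -
        Ψ (Matrix.vecCons x Y) ^ 2) * W₁ x Y +
      ∑ Y : Fin n → T, ∑ x, (η x * (∑ x', Ψ (Matrix.vecCons x' Y) ^ 2) -
        Ψ (Matrix.vecCons x Y) ^ 2) * W₂ x Y := by
  simp only [mul_add, Finset.sum_add_distrib]

omit [Nonempty T] in
/-- **Sup form, no symmetry**: for `W ≥ 0` with `∑ₓ η(x) W(x,Y) ≤ M` for every environment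
`Y`, `∑_Y ∑ₓ (η(x) S_Y - Ψ(x,Y)²) W(x,Y) ≤ M Z` (drop the conditional expectation of `W ≥ 0`). -/
theorem SoloInformed.sum_teleportation_le_of_nonneg
    (Ψ : (Fin (n + 1) → T) → ℝ) (η : T → ℝ)
    (W : T → (Fin n → T) → ℝ) (hW0 : ∀ x Y, 0 ≤ W x Y) {M : ℝ}
    (hM : ∀ Y : Fin n → T, ∑ x, η x * W x Y ≤ M) :
    ∑ Y : Fin n → T, ∑ x, (η x * (∑ x', Ψ (Matrix.vecCons x' Y) ^ 2) -
        Ψ (Matrix.vecCons x Y) ^ 2) * W x Y ≤ M * ∑ X, Ψ X ^ 2 := by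
  have hZ' : ∑ X, Ψ X ^ 2 = ∑ Y : Fin n → T, ∑ x', Ψ (Matrix.vecCons x' Y) ^ 2 := by
    rw [SoloInformed.sum_config_eq_sum_vecCons (fun X => Ψ X ^ 2)]; exact Finset.sum_comm
  have hS0 : ∀ Y : Fin n → T, 0 ≤ ∑ x', Ψ (Matrix.vecCons x' Y) ^ 2 := fun Y =>
    Finset.sum_nonneg fun x _ => sq_nonneg _
  calc ∑ Y : Fin n → T, ∑ x, (η x * (∑ x', Ψ (Matrix.vecCons x' Y) ^ 2) -
        Ψ (Matrix.vecCons x Y) ^ 2) * W x Y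
      ≤ ∑ Y : Fin n → T, ∑ x, η x * (∑ x', Ψ (Matrix.vecCons x' Y) ^ 2) * W x Y := by
        refine Finset.sum_le_sum fun Y _ => Finset.sum_le_sum fun x _ => ?_
        nlinarith [hW0 x Y, sq_nonneg (Ψ (Matrix.vecCons x Y))]
    _ = ∑ Y : Fin n → T, (∑ x', Ψ (Matrix.vecCons x' Y) ^ 2) * ∑ x, η x * W x Y := by
        refine Finset.sum_congr rfl fun Y _ => ?_
        rw [Finset.mul_sum]
        exact Finset.sum_congr rfl fun x _ => by ring
    _ ≤ ∑ Y : Fin n → T, (∑ x', Ψ (Matrix.vecCons x' Y) ^ 2) * M :=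
        Finset.sum_le_sum fun Y _ => mul_le_mul_of_nonneg_left (hM Y) (hS0 Y)
    _ = M * ∑ X, Ψ X ^ 2 := by rw [← Finset.sum_mul, hZ', mul_comm]

omit [Nonempty T] in
/-- Exchangeability: under a symmetric weight `Ψ²`, `E f(Xᵢ) = E f(X₀)`. -/
theorem SoloInformed.sum_sq_mul_apply_eq_apply_zero (Ψ : (Fin (n + 1) → T) → ℝ)
    (hsymm : ∀ (σ : Equiv.Perm (Fin (n + 1))) (X : Fin (n + 1) → T), Ψ (X ∘ σ) = Ψ X)
    (f : T → ℝ) (i : Fin (n + 1)) :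
    ∑ X, Ψ X ^ 2 * f (X i) = ∑ X, Ψ X ^ 2 * f (X 0) := by
  rw [← SoloInformed.sum_config_comp_perm (fun X => Ψ X ^ 2 * f (X i)) (Equiv.swap 0 i)]
  refine Finset.sum_congr rfl fun X _ => ?_
  simp only [Function.comp_apply, Equiv.swap_apply_right, hsymm]

/-- `E f(X₀) = Z ∑ η f`. -/
theorem SoloInformed.sum_sq_mul_apply_zero
    (Ψ : (Fin (n + 1) → T) → ℝ) (hg : ∀ (x : T) (Y : Fin n → T), 0 < Ψ (Matrix.vecCons x Y))
    (η : T → ℝ) (hη : ∀ x, η x = (∑ Y : Fin n → T, Ψ (Matrix.vecCons x Y) ^ 2) / ∑ X, Ψ X ^ 2)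
    (f : T → ℝ) :
    ∑ X, Ψ X ^ 2 * f (X 0) = (∑ X, Ψ X ^ 2) * ∑ x, η x * f x := by
  obtain ⟨-, -, -, hmarg⟩ := SoloInformed.density_pos_and_sum_eq_one Ψ hg η hη
  rw [SoloInformed.sum_config_eq_sum_vecCons (fun X => Ψ X ^ 2 * f (X 0))]
  simp only [Matrix.cons_val_zero]
  rw [Finset.mul_sum]
  refine Finset.sum_congr rfl fun x _ => ?_
  rw [← Finset.sum_mul, hmarg]
  ring

/-- **Pair identity**: for symmetric `Ψ` and `W(x,Y) = ∑ⱼ K(x,Yⱼ)` (any kernel `K`),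
`∑_Y ∑ₓ (η(x) S_Y - Ψ(x,Y)²) W(x,Y) = n q Z - E'` with `q = ∑_y η(y) ∑ₓ η(x) K(x,y)` and
`E' = ∑_X Ψ(X)² ∑_{j≥1} K(X₀, Xⱼ)`. -/
theorem SoloInformed.sum_teleportation_pair_eq
    (Ψ : (Fin (n + 1) → T) → ℝ) (hg : ∀ (x : T) (Y : Fin n → T), 0 < Ψ (Matrix.vecCons x Y))
    (hsymm : ∀ (σ : Equiv.Perm (Fin (n + 1))) (X : Fin (n + 1) → T), Ψ (X ∘ σ) = Ψ X)
    (η : T → ℝ) (hη : ∀ x, η x = (∑ Y : Fin n → T, Ψ (Matrix.vecCons x Y) ^ 2) / ∑ X, Ψ X ^ 2)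
    (K : T → T → ℝ) :
    ∑ Y : Fin n → T, ∑ x, (η x * (∑ x', Ψ (Matrix.vecCons x' Y) ^ 2) -
        Ψ (Matrix.vecCons x Y) ^ 2) * ∑ j, K x (Y j) =
      n * ((∑ y, η y * ∑ x, η x * K x y) * ∑ X, Ψ X ^ 2) -
        ∑ X, Ψ X ^ 2 * ∑ j : Fin n, K (X 0) (X j.succ) := by
  have hsplit : ∀ Φ : (Fin (n + 1) → T) → ℝ,
      ∑ X, Φ X = ∑ x, ∑ Y, Φ (Matrix.vecCons x Y) := SoloInformed.sum_config_eq_sum_vecCons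
  have hexch := SoloInformed.sum_sq_mul_apply_eq_apply_zero Ψ hsymm
  have hfirst := SoloInformed.sum_sq_mul_apply_zero Ψ hg η hη
  obtain ⟨Z, hZ⟩ : ∃ r : ℝ, r = ∑ X, Ψ X ^ 2 := ⟨_, rfl⟩
  rw [← hZ] at hfirst ⊢
  obtain ⟨Kη, hKη⟩ : ∃ f : T → ℝ, f = fun y => ∑ x, η x * K x y := ⟨_, rfl⟩
  obtain ⟨q, hq⟩ : ∃ r : ℝ, r = ∑ y, η y * Kη y := ⟨_, rfl⟩
  have hqexp : ∑ y, η y * ∑ x, η x * K x y = q := by rw [hq, hKη]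
  rw [hqexp]
  -- (E1)  `∑_Y S_Y ∑ₓ η(x) W_Y(x) = n · q · Z`
  have hE1 : ∑ Y : Fin n → T, (∑ x', Ψ (Matrix.vecCons x' Y) ^ 2) *
      ∑ x, η x * ∑ j, K x (Y j) = n * (q * Z) := by
    have h1 : ∀ Y : Fin n → T, ∑ x, η x * ∑ j, K x (Y j) = ∑ j, Kη (Y j) := fun Y => by
      rw [hKη]
      simp only [Finset.mul_sum]
      exact Finset.sum_comm
    have h2 : ∀ j : Fin n,
        ∑ Y : Fin n → T, (∑ x', Ψ (Matrix.vecCons x' Y) ^ 2) * Kη (Y j) = q * Z := fun j => by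
      calc ∑ Y : Fin n → T, (∑ x', Ψ (Matrix.vecCons x' Y) ^ 2) * Kη (Y j)
          = ∑ Y : Fin n → T, ∑ x', Ψ (Matrix.vecCons x' Y) ^ 2 * Kη (Y j) :=
            Finset.sum_congr rfl fun Y _ => Finset.sum_mul _ _ _
        _ = ∑ x', ∑ Y : Fin n → T, Ψ (Matrix.vecCons x' Y) ^ 2 * Kη (Y j) := Finset.sum_comm
        _ = ∑ X, Ψ X ^ 2 * Kη (X j.succ) := by
            rw [hsplit (fun X => Ψ X ^ 2 * Kη (X j.succ))]
            simp only [Matrix.cons_val_succ]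
        _ = ∑ X, Ψ X ^ 2 * Kη (X 0) := hexch Kη j.succ
        _ = q * Z := by rw [hfirst Kη, hq, mul_comm]
    calc ∑ Y : Fin n → T, (∑ x', Ψ (Matrix.vecCons x' Y) ^ 2) * ∑ x, η x * ∑ j, K x (Y j)
        = ∑ Y : Fin n → T, ∑ j, (∑ x', Ψ (Matrix.vecCons x' Y) ^ 2) * Kη (Y j) := by
          refine Finset.sum_congr rfl fun Y _ => ?_
          rw [h1 Y, Finset.mul_sum]
      _ = ∑ j : Fin n, ∑ Y : Fin n → T, (∑ x', Ψ (Matrix.vecCons x' Y) ^ 2) * Kη (Y j) :=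
          Finset.sum_comm
      _ = ∑ _j : Fin n, q * Z := Finset.sum_congr rfl fun j _ => h2 j
      _ = n * (q * Z) := by
          rw [Finset.sum_const, Finset.card_univ, Fintype.card_fin, nsmul_eq_mul]
  -- (E2)  `∑_Y ∑ₓ Ψ(x,Y)² W_Y(x) = E'`
  have hE2 : ∑ Y : Fin n → T, ∑ x, Ψ (Matrix.vecCons x Y) ^ 2 * ∑ j, K x (Y j) =
      ∑ X, Ψ X ^ 2 * ∑ j : Fin n, K (X 0) (X j.succ) := by
    rw [hsplit (fun X => Ψ X ^ 2 * ∑ j : Fin n, K (X 0) (X j.succ))]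
    simp only [Matrix.cons_val_zero, Matrix.cons_val_succ]
    exact Finset.sum_comm
  rw [← hE1, ← hE2, ← Finset.sum_sub_distrib]
  refine Finset.sum_congr rfl fun Y _ => ?_
  rw [Finset.mul_sum, ← Finset.sum_sub_distrib]
  refine Finset.sum_congr rfl fun x _ => ?_
  ring

omit [Nonempty T] in
/-- `q = ⟨η, K η⟩ ≥ 0` for a positive semi-definite kernel. -/
theorem SoloInformed.smearedSelfEnergy_nonneg (K : T → T → ℝ)
    (hK : ∀ (m : ℕ) (z : Fin m → T) (c : Fin m → ℝ), 0 ≤ ∑ i, ∑ j, c i * c j * K (z i) (z j))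
    (η : T → ℝ) : 0 ≤ ∑ y, η y * ∑ x, η x * K x y := by
  have h0 := SoloInformed.posDef_sum_fintype hK id η
  calc (0 : ℝ) ≤ ∑ i, ∑ j, η i * η j * K (id i) (id j) := h0
    _ = ∑ x, ∑ y, η y * (η x * K x y) :=
        Finset.sum_congr rfl fun x _ => Finset.sum_congr rfl fun y _ => by rw [id, id]; ring
    _ = ∑ y, η y * ∑ x, η x * K x y := by rw [Finset.sum_comm]; simp only [Finset.mul_sum]

/-- **Positive type bounds the pair correlation sum from below**: for `K` symmetric, positive
semi-definite on finite families with `K(x,x) ≤ κ`, and symmetric `Ψ`,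
`E' = ∑_X Ψ(X)² ∑_{j≥1} K(X₀,Xⱼ) ≥ ((n+1) q - κ) Z`. Proof: `0 ≤ ⟨μ_X, K μ_X⟩` for the signed
measure `μ_X = ∑ᵢ δ_{Xᵢ} - (n+1) η`, averaged over `X` with weight `Ψ(X)²`, using
exchangeability [cite: Ruelle1969, §3.2]. -/
theorem SoloInformed.pairSum_ge_of_posDef
    (K : T → T → ℝ) (hKs : ∀ x y, K x y = K y x)
    (hK : ∀ (m : ℕ) (z : Fin m → T) (c : Fin m → ℝ), 0 ≤ ∑ i, ∑ j, c i * c j * K (z i) (z j))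
    {κ : ℝ} (hκ : ∀ x, K x x ≤ κ)
    (Ψ : (Fin (n + 1) → T) → ℝ) (hg : ∀ (x : T) (Y : Fin n → T), 0 < Ψ (Matrix.vecCons x Y))
    (hsymm : ∀ (σ : Equiv.Perm (Fin (n + 1))) (X : Fin (n + 1) → T), Ψ (X ∘ σ) = Ψ X)
    (η : T → ℝ) (hη : ∀ x, η x = (∑ Y : Fin n → T, Ψ (Matrix.vecCons x Y) ^ 2) / ∑ X, Ψ X ^ 2) :
    ((n + 1) * (∑ y, η y * ∑ x, η x * K x y) - κ) * ∑ X, Ψ X ^ 2 ≤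
      ∑ X, Ψ X ^ 2 * ∑ j : Fin n, K (X 0) (X j.succ) := by
  have hexch := SoloInformed.sum_sq_mul_apply_eq_apply_zero Ψ hsymm
  have hfirst := SoloInformed.sum_sq_mul_apply_zero Ψ hg η hη
  obtain ⟨Z, hZ⟩ : ∃ r : ℝ, r = ∑ X, Ψ X ^ 2 := ⟨_, rfl⟩
  rw [← hZ] at hfirst ⊢
  obtain ⟨Kη, hKη⟩ : ∃ f : T → ℝ, f = fun y => ∑ x, η x * K x y := ⟨_, rfl⟩
  obtain ⟨q, hq⟩ : ∃ r : ℝ, r = ∑ y, η y * Kη y := ⟨_, rfl⟩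
  have hqexp : ∑ y, η y * ∑ x, η x * K x y = q := by rw [hq, hKη]
  rw [hqexp]
  obtain ⟨E', hE'⟩ : ∃ r : ℝ, r = ∑ X, Ψ X ^ 2 * ∑ j : Fin n, K (X 0) (X j.succ) := ⟨_, rfl⟩
  rw [← hE']
  -- positive semi-definiteness on `∑ᵢ δ_{Xᵢ} - (n+1) η`
  have hpsd : ∀ X : Fin (n + 1) → T,
      0 ≤ ∑ i, ∑ j, K (X i) (X j) - 2 * (n + 1) * ∑ i, Kη (X i) + (n + 1) ^ 2 * q := by
    intro X
    have h0 := SoloInformed.posDef_sum_fintype hK (Sum.elim X (fun y => y))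
      (Sum.elim (fun _ => (1 : ℝ)) (fun y => -((n + 1 : ℝ) * η y)))
    rw [Fintype.sum_sum_type] at h0
    simp only [Fintype.sum_sum_type, Sum.elim_inl, Sum.elim_inr] at h0
    rw [Finset.sum_add_distrib, Finset.sum_add_distrib] at h0
    simp only [one_mul, mul_one] at h0
    have hc2 : ∑ i : Fin (n + 1), ∑ y, -((n + 1 : ℝ) * η y) * K (X i) y =
        -((n + 1) * ∑ i, Kη (X i)) := by
      rw [hKη, Finset.mul_sum, ← Finset.sum_neg_distrib]
      refine Finset.sum_congr rfl fun i _ => ?_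
      simp only [Finset.mul_sum, ← Finset.sum_neg_distrib]
      refine Finset.sum_congr rfl fun y _ => ?_
      rw [hKs (X i) y]
      ring
    have hc3 : ∑ y, ∑ j : Fin (n + 1), -((n + 1 : ℝ) * η y) * K y (X j) =
        -((n + 1) * ∑ i, Kη (X i)) := by
      rw [hKη, Finset.sum_comm, Finset.mul_sum, ← Finset.sum_neg_distrib]
      refine Finset.sum_congr rfl fun i _ => ?_
      simp only [Finset.mul_sum, ← Finset.sum_neg_distrib]
      exact Finset.sum_congr rfl fun y _ => by ring
    have hc4 : ∑ y, ∑ y', -((n + 1 : ℝ) * η y) * -((n + 1 : ℝ) * η y') * K y y' =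
        (n + 1) ^ 2 * q := by
      rw [hq, hKη, Finset.mul_sum, Finset.sum_comm]
      refine Finset.sum_congr rfl fun y' _ => ?_
      simp only [Finset.mul_sum]
      exact Finset.sum_congr rfl fun y _ => by rw [hKs y y']; ring
    rw [hc2, hc3, hc4] at h0
    linarith
  have hdiag : ∑ X, Ψ X ^ 2 * ∑ i, K (X i) (X i) ≤ (n + 1) * κ * Z := by
    calc ∑ X, Ψ X ^ 2 * ∑ i, K (X i) (X i) ≤ ∑ X, Ψ X ^ 2 * ((n + 1) * κ) := by
          refine Finset.sum_le_sum fun X _ => mul_le_mul_of_nonneg_left ?_ (sq_nonneg _)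
          calc ∑ i, K (X i) (X i) ≤ ∑ _i : Fin (n + 1), κ := Finset.sum_le_sum fun i _ => hκ (X i)
            _ = (n + 1) * κ := by
                rw [Finset.sum_const, Finset.card_univ, Fintype.card_fin, nsmul_eq_mul,
                  Nat.cast_add, Nat.cast_one]
      _ = (n + 1) * κ * Z := by rw [← Finset.sum_mul, ← hZ]; ring
  have hoff : ∀ i : Fin (n + 1), ∑ X, Ψ X ^ 2 * (∑ j, K (X i) (X j) - K (X i) (X i)) = E' := by
    intro i
    rw [hE', ← SoloInformed.sum_config_comp_perm
      (fun X => Ψ X ^ 2 * (∑ j, K (X i) (X j) - K (X i) (X i))) (Equiv.swap 0 i)]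
    refine Finset.sum_congr rfl fun X _ => ?_
    simp only [Function.comp_apply, Equiv.swap_apply_right, hsymm]
    have hs : ∑ j, K (X 0) (X (Equiv.swap 0 i j)) = ∑ j, K (X 0) (X j) :=
      Equiv.sum_comp (Equiv.swap 0 i) (fun j => K (X 0) (X j))
    rw [hs, Fin.sum_univ_succ]
    ring
  have hpair : ∑ X, Ψ X ^ 2 * ∑ i, ∑ j, K (X i) (X j) =
      ∑ X, Ψ X ^ 2 * ∑ i, K (X i) (X i) + (n + 1) * E' := by
    have h1 : ∀ X : Fin (n + 1) → T, Ψ X ^ 2 * ∑ i, ∑ j, K (X i) (X j) =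
        Ψ X ^ 2 * ∑ i, K (X i) (X i) + ∑ i, Ψ X ^ 2 * (∑ j, K (X i) (X j) - K (X i) (X i)) := by
      intro X
      rw [← Finset.mul_sum, Finset.sum_sub_distrib]
      ring
    rw [Finset.sum_congr rfl fun X _ => h1 X, Finset.sum_add_distrib, Finset.sum_comm,
      Finset.sum_congr rfl fun i _ => hoff i, Finset.sum_const, Finset.card_univ, Fintype.card_fin,
      nsmul_eq_mul, Nat.cast_add, Nat.cast_one]
  have hlin : ∑ X, Ψ X ^ 2 * ∑ i, Kη (X i) = (n + 1) * (Z * q) := by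
    have h1 : ∀ i : Fin (n + 1), ∑ X, Ψ X ^ 2 * Kη (X i) = Z * q := fun i => by
      rw [hexch Kη i, hfirst Kη, hq]
    calc ∑ X, Ψ X ^ 2 * ∑ i, Kη (X i) = ∑ X, ∑ i, Ψ X ^ 2 * Kη (X i) :=
          Finset.sum_congr rfl fun X _ => Finset.mul_sum _ _ _
      _ = ∑ i : Fin (n + 1), ∑ X, Ψ X ^ 2 * Kη (X i) := Finset.sum_comm
      _ = ∑ _i : Fin (n + 1), Z * q := Finset.sum_congr rfl fun i _ => h1 i
      _ = (n + 1) * (Z * q) := by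
          rw [Finset.sum_const, Finset.card_univ, Fintype.card_fin, nsmul_eq_mul, Nat.cast_add,
            Nat.cast_one]
  have hsumP : 0 ≤ ∑ X, Ψ X ^ 2 *
      (∑ i, ∑ j, K (X i) (X j) - 2 * (n + 1) * ∑ i, Kη (X i) + (n + 1) ^ 2 * q) :=
    Finset.sum_nonneg fun X _ => mul_nonneg (sq_nonneg _) (hpsd X)
  have hexp : ∑ X, Ψ X ^ 2 *
      (∑ i, ∑ j, K (X i) (X j) - 2 * (n + 1) * ∑ i, Kη (X i) + (n + 1) ^ 2 * q) =
      (∑ X, Ψ X ^ 2 * ∑ i, K (X i) (X i)) + (n + 1) * E' -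
        2 * (n + 1) * ((n + 1) * (Z * q)) + (n + 1) ^ 2 * q * Z := by
    have h1 : ∀ X : Fin (n + 1) → T, Ψ X ^ 2 *
        (∑ i, ∑ j, K (X i) (X j) - 2 * (n + 1) * ∑ i, Kη (X i) + (n + 1) ^ 2 * q) =
        Ψ X ^ 2 * ∑ i, ∑ j, K (X i) (X j) - 2 * (n + 1) * (Ψ X ^ 2 * ∑ i, Kη (X i)) +
          (n + 1) ^ 2 * q * Ψ X ^ 2 := fun X => by ring
    rw [Finset.sum_congr rfl fun X _ => h1 X, Finset.sum_add_distrib, Finset.sum_sub_distrib,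
      ← Finset.mul_sum, ← Finset.mul_sum, hpair, hlin, ← hZ]
  rw [hexp] at hsumP
  have h3 : (n + 1 : ℝ) * 0 ≤ (n + 1) * (κ * Z + E' - (n + 1) * Z * q) := by
    rw [mul_zero]
    nlinarith [hsumP, hdiag]
  have h4 := le_of_mul_le_mul_left h3 (by positivity : (0 : ℝ) < n + 1)
  nlinarith [h4]

/-- **A positive-type pair term costs at most its self-energy, in every symmetric state**:
`∑_Y ∑ₓ (η(x) S_Y - Ψ(x,Y)²) ∑ⱼ K(x,Yⱼ) ≤ (κ - q) Z ≤ κ Z` (`q ≥ 0` by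
`SoloInformed.smearedSelfEnergy_nonneg`). No slice structure of `Ψ` is assumed. -/
theorem SoloInformed.sum_teleportation_pair_le_selfEnergy
    (K : T → T → ℝ) (hKs : ∀ x y, K x y = K y x)
    (hK : ∀ (m : ℕ) (z : Fin m → T) (c : Fin m → ℝ), 0 ≤ ∑ i, ∑ j, c i * c j * K (z i) (z j))
    {κ : ℝ} (hκ : ∀ x, K x x ≤ κ)
    (Ψ : (Fin (n + 1) → T) → ℝ) (hg : ∀ (x : T) (Y : Fin n → T), 0 < Ψ (Matrix.vecCons x Y))
    (hsymm : ∀ (σ : Equiv.Perm (Fin (n + 1))) (X : Fin (n + 1) → T), Ψ (X ∘ σ) = Ψ X)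
    (η : T → ℝ) (hη : ∀ x, η x = (∑ Y : Fin n → T, Ψ (Matrix.vecCons x Y) ^ 2) / ∑ X, Ψ X ^ 2) :
    ∑ Y : Fin n → T, ∑ x, (η x * (∑ x', Ψ (Matrix.vecCons x' Y) ^ 2) -
        Ψ (Matrix.vecCons x Y) ^ 2) * ∑ j, K x (Y j) ≤
      (κ - ∑ y, η y * ∑ x, η x * K x y) * ∑ X, Ψ X ^ 2 := by
  rw [SoloInformed.sum_teleportation_pair_eq Ψ hg hsymm η hη K]
  have h := SoloInformed.pairSum_ge_of_posDef K hKs hK hκ Ψ hg hsymm η hη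
  nlinarith [h]

/-- **A pointwise non-negative pair term costs at most `n q`** (`≈ ρ ∫ K` in the continuum),
in every symmetric state: `∑_Y ∑ₓ (η(x) S_Y - Ψ(x,Y)²) ∑ⱼ K(x,Yⱼ) ≤ n q Z`. -/
theorem SoloInformed.sum_teleportation_pair_le_of_nonneg
    (K : T → T → ℝ) (hK0 : ∀ x y, 0 ≤ K x y)
    (Ψ : (Fin (n + 1) → T) → ℝ) (hg : ∀ (x : T) (Y : Fin n → T), 0 < Ψ (Matrix.vecCons x Y))
    (hsymm : ∀ (σ : Equiv.Perm (Fin (n + 1))) (X : Fin (n + 1) → T), Ψ (X ∘ σ) = Ψ X)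
    (η : T → ℝ) (hη : ∀ x, η x = (∑ Y : Fin n → T, Ψ (Matrix.vecCons x Y) ^ 2) / ∑ X, Ψ X ^ 2) :
    ∑ Y : Fin n → T, ∑ x, (η x * (∑ x', Ψ (Matrix.vecCons x' Y) ^ 2) -
        Ψ (Matrix.vecCons x Y) ^ 2) * ∑ j, K x (Y j) ≤
      n * ((∑ y, η y * ∑ x, η x * K x y) * ∑ X, Ψ X ^ 2) := by
  rw [SoloInformed.sum_teleportation_pair_eq Ψ hg hsymm η hη K]
  have h : 0 ≤ ∑ X, Ψ X ^ 2 * ∑ j : Fin n, K (X 0) (X j.succ) :=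
    Finset.sum_nonneg fun X _ => mul_nonneg (sq_nonneg _) (Finset.sum_nonneg fun j _ => hK0 _ _)
  linarith

end Teleportation

end Summit.AtomisticToContinuum.BoseEinsteinCondensation.Theorems

end
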